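import Summits.CriticalPhenomena.CardyFormulaZ2.Theses.CardyQContinuation
import Summits.CriticalPhenomena.CardyFormulaZ2.Theorems.CardyBoundaryCoulombGasRectilinearSufficesLowerSandwich
import Summits.CriticalPhenomena.CardyFormulaZ2.Theorems.CardyQContinuationIsingJetsConformalStubPolygonLoopDistLe
import Literature.Probability.RandomPlanarGeometry.JordanBoundaryLemmas

/-!
# Crux `IsingJetsConformal`, stub `stub_design_lower_continuum`, part 2:
# reading perturbations of the narrow-and-tall model rectangle in an oriented square model
# (route `CardyQContinuation`, item stmt-CriticalPhenomena-5560, `n = 0` bridge)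

Let `Ψ : ℂ ≃ₜ ℂ` be a square model of the conformal rectangle `R` (`Ψ` maps the open model square
`(-1, 1)²` onto `R`, its bottom side onto `R.arc 0`, its top side onto `R.arc 2` and the union of
its vertical sides onto `R.arc 1 ∪ R.arc 3`). For `t > 0` let
`D⁻ₜ = Ψ((-1 + t, 1 - t) × (-1 - t, 1 + t))` be the image of the NARROWER-and-TALLER rectangle
(`perturbQuad`): it lies inside `R` across the free arcs `1, 3` and sticks out of `closure R`
across the arcs `0, 2`. The LOWER comparison domain `R⁻` of the `n = 0` sandwich of the crux is a
rectilinear shadow of `D⁻ₜ`; this file proves the part of its specification which only uses that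
`∂R⁻` is uniformly close to `∂D⁻ₜ` with the same marks (`DesignLowerContinuum.exists_lower_geometry`):
given `sOut > 0` and `ε > 0` there are `t ∈ (0, 1/2)` and `ε₁ > 0` such that every conformal
rectangle `P` with the quarter marks and `∂P` uniformly `ε₁`-close to `∂D⁻ₜ` satisfies

* `∂P` is uniformly `ε`-close to the boundary loop of the re-modelled quad `unitSquareQuad.map Ψ`;
* `P.arc 0 ∪ P.arc 2 ⊆ (closure R)ᶜ` and `closure P ∩ (R.arc 1 ∪ R.arc 3) = ∅`;
* for some `sIn > 0`, every point of `closure P` outside the `sIn`-interior of `R` is within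
  `sOut` of `R.arc 0` or of `R.arc 2`, and `P.arc 0`, `P.arc 2` are within `sOut` of `R.arc 0`,
  `R.arc 2`.

Proof ("reading in the model", as in the tree's `exists_lower_sandwich` /
`exists_upper_sandwich`): `Ψ` is uniformly continuous on `[-2, 2]²` and `Ψ⁻¹` is uniformly
continuous near the closed model rectangle (`exists_forall_dist_symm_le`), so a point of
`closure P` reads in the model inside the `ε₂`-neighbourhood of `[-1+t, 1-t] × [-1-t, 1+t]`
(`mem_closure_or_infDist_le`), a point of `P.arc 0` reads within `ε₂` of the bottom side
`[-1+t, 1-t] × {-1-t}` (`exists_param_of_mem_arc`), etc.; with `ε₂ = t/4` and `2t` below the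
continuity modulus of `Ψ` for `sOut/2` the listed inclusions follow from elementary inequalities,
and the closeness of `∂D⁻ₜ` to `∂(unitSquareQuad.map Ψ)` from that of the two corner lists
(`PolygonLoopDistLe.dist_polygonLoop_le`). No new mathematics. [folklore]
-/

noncomputable section

namespace Summit.CriticalPhenomena.CardyFormulaZ2.Theorems.CardyQContinuation

open Set Metric Filter Topology Complex
open Literature.Probability.RandomPlanarGeometry Literature.Probability.Percolation
open Literature.Probability.LatticeModels
open Summit.CriticalPhenomena.CardyFormulaZ2.Theorems

namespace DesignLowerContinuum

/-- Corresponding corners of two model rectangles are within the sum of the half-width and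
half-height differences. [folklore] -/
theorem dist_rectVerts_getElem_le (a b a' b' : ℝ) {i : ℕ} (hi : i < 4) :
    dist ((rectVerts a b)[i]'(by simpa using hi)) ((rectVerts a' b')[i]'(by simpa using hi)) ≤
      |a - a'| + |b - b'| := by
  rw [Complex.dist_eq]
  refine (Complex.norm_le_abs_re_add_abs_im _).trans ?_
  interval_cases i
  · simp only [rectVerts, List.getElem_cons_zero, sub_re, sub_im]
    rw [show -a - -a' = -(a - a') by ring, show -b - -b' = -(b - b') by ring, abs_neg, abs_neg]
  · simp only [rectVerts, List.getElem_cons_succ, List.getElem_cons_zero, sub_re, sub_im]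
    rw [show -b - -b' = -(b - b') by ring, abs_neg]
  · simp only [rectVerts, List.getElem_cons_succ, List.getElem_cons_zero, sub_re, sub_im]
    rfl
  · simp only [rectVerts, List.getElem_cons_succ, List.getElem_cons_zero, sub_re, sub_im]
    rw [show -a - -a' = -(a - a') by ring, abs_neg]

/-- The points of the closed polygon through the corners of the model rectangle
`(-a, a) × (-b, b)` lie in the closed rectangle. [folklore] -/
theorem polygonLoop_rectVerts_mem {a b : ℝ} (ha : 0 < a) (hb : 0 < b) (s : ℝ) :
    (polygonLoop (rectVerts a b) s).re ∈ Icc (-a) a ∧ (polygonLoop (rectVerts a b) s).im ∈ Icc (-b) b := by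
  have h : polygonLoop (rectVerts a b) s ∈ closure (symRect a b) := by
    refine frontier_subset_closure ?_
    rw [← range_polygonLoop_rectVerts ha hb]
    exact mem_range_self s
  rw [mem_closure_symRect ha hb] at h
  exact ⟨⟨h.1.1, h.1.2⟩, h.2.1, h.2.2⟩

/-- The re-modelled quad is the unperturbed model rectangle. [folklore] -/
theorem map_unitSquareQuad_eq (Ψ : ℂ ≃ₜ ℂ) :
    unitSquareQuad.map Ψ = perturbQuad Ψ (-1) 1 (-1) 1 (by norm_num) (by norm_num) := rfl

/-- **The boundary loop of the narrow-and-tall perturbed rectangle is uniformly close to that of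
the re-modelled quad** for small `t`: both are `Ψ ∘` (closed polygon through four corners), the
corners are `2t`-close, and `Ψ` is uniformly continuous on `[-2, 2]²`. [folklore] -/
theorem exists_forall_dist_perturbQuad_boundary_le (Ψ : ℂ ≃ₜ ℂ) {ε : ℝ} (hε : 0 < ε) :
    ∃ t₀ > 0, ∀ (t : ℝ) (ht : 0 < t) (_ : t ≤ t₀) (ht1 : t < 1) (s : ℝ),
      dist ((perturbQuad Ψ (-1 + t) (1 - t) (-1 - t) (1 + t) (by linarith) (by linarith)).boundary s)
        ((unitSquareQuad.map Ψ).boundary s) ≤ ε := by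
  set K₂ : Set ℂ := Icc (-2) 2 ×ℂ Icc (-2) 2 with hK₂
  have hK₂c : IsCompact K₂ := isCompact_Icc.reProdIm isCompact_Icc
  obtain ⟨η, hη, hΨ⟩ := Metric.uniformContinuousOn_iff_le.1
    (hK₂c.uniformContinuousOn_of_continuous Ψ.continuous.continuousOn) ε hε
  refine ⟨η / 2, by positivity, fun t ht htη ht1 s => ?_⟩
  rw [perturbQuad_boundary, map_unitSquareQuad_eq, perturbQuad_boundary]
  have hc : (⟨(-1 + t + (1 - t)) / 2, (-1 - t + (1 + t)) / 2⟩ : ℂ) = 0 := by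
    apply Complex.ext <;> simp
  have hc' : (⟨(-1 + 1) / 2, (-1 + 1) / 2⟩ : ℂ) = 0 := by
    apply Complex.ext <;> simp
  rw [hc, hc', add_zero, add_zero, show (1 - t - (-1 + t)) / 2 = 1 - t by ring,
    show (1 + t - (-1 - t)) / 2 = 1 + t by ring, show ((1 : ℝ) - -1) / 2 = 1 by norm_num]
  -- the two model points are `2t`-close and lie in `[-2, 2]²`
  have hd : dist (polygonLoop (rectVerts (1 - t) (1 + t)) s) (polygonLoop (rectVerts 1 1) s) ≤ 2 * t := by
    refine PolygonLoopDistLe.dist_polygonLoop_le (by positivity) (by simp) (fun i hi => ?_) s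
    have hi4 : i < 4 := by simpa using hi
    refine (dist_rectVerts_getElem_le (1 - t) (1 + t) 1 1 hi4).trans ?_
    rw [show (1 : ℝ) - t - 1 = -t by ring, show (1 : ℝ) + t - 1 = t by ring, abs_neg,
      abs_of_pos ht]
    linarith
  obtain ⟨h1, h2⟩ := polygonLoop_rectVerts_mem (a := 1 - t) (b := 1 + t) (by linarith) (by linarith) s
  obtain ⟨h3, h4⟩ := polygonLoop_rectVerts_mem (a := 1) (b := 1) one_pos one_pos s
  refine hΨ _ (mem_reProdIm.2 ⟨⟨?_, ?_⟩, ?_, ?_⟩) _ (mem_reProdIm.2 ⟨⟨?_, ?_⟩, ?_, ?_⟩)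
    (hd.trans (by linarith)) <;>
    linarith [h1.1, h1.2, h2.1, h2.2, h3.1, h3.2, h4.1, h4.2]

/-- **Near points of the model have near images**, read as a bound on the distance to an arc: if
`Ψ` maps the horizontal side `[-1, 1] × {y}` into `A`, two points of `[-2, 2]²` at distance `≤ d`
have images at distance `< sOut`, and `w ∈ [-2, 2]²` has `w.re ∈ [-1, 1]` and `|w.im - y| ≤ d`,
then `Ψ w` is within `sOut` of `A`. [folklore] -/
theorem infDist_image_lt {Ψ : ℂ ≃ₜ ℂ} {A : Set ℂ} {y sOut d : ℝ} (hy : y ∈ Icc (-2 : ℝ) 2)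
    (hside : ∀ x ∈ Icc (-1 : ℝ) 1, Ψ ⟨x, y⟩ ∈ A)
    (hnear : ∀ w ∈ Icc (-2 : ℝ) 2 ×ℂ Icc (-2 : ℝ) 2, ∀ w' ∈ Icc (-2 : ℝ) 2 ×ℂ Icc (-2 : ℝ) 2,
      dist w w' ≤ d → dist (Ψ w) (Ψ w') < sOut)
    {w : ℂ} (hw : w ∈ Icc (-2 : ℝ) 2 ×ℂ Icc (-2 : ℝ) 2) (hre : w.re ∈ Icc (-1 : ℝ) 1)
    (him : |w.im - y| ≤ d) : infDist (Ψ w) A < sOut := by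
  set w' : ℂ := ⟨w.re, y⟩ with hw'
  have hw'K : w' ∈ Icc (-2 : ℝ) 2 ×ℂ Icc (-2 : ℝ) 2 :=
    mem_reProdIm.2 ⟨⟨by linarith [hre.1], by linarith [hre.2]⟩, hy⟩
  have hdist : dist w w' ≤ d := by
    rw [Complex.dist_eq]
    refine (Complex.norm_le_abs_re_add_abs_im _).trans ?_
    simpa [hw'] using him
  calc infDist (Ψ w) A ≤ dist (Ψ w) (Ψ w') := infDist_le_dist_of_mem (hside w.re hre)
    _ < sOut := hnear w hw w' hw'K hdist

/-- **Reading perturbations of the narrow-and-tall model rectangle in an oriented square model.**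
See the module docstring. [folklore] -/
theorem exists_lower_geometry {R : ConformalRectangle} {Ψ : ℂ ≃ₜ ℂ}
    (hcar : Ψ '' unitSquareQuad.carrier = R.carrier)
    (h0 : Ψ '' unitSquareQuad.arc 0 = R.arc 0) (h2 : Ψ '' unitSquareQuad.arc 2 = R.arc 2)
    (h13 : Ψ '' (unitSquareQuad.arc 1 ∪ unitSquareQuad.arc 3) = R.arc 1 ∪ R.arc 3)
    {sOut ε : ℝ} (hsOut : 0 < sOut) (hε : 0 < ε) :
    ∃ (t : ℝ) (ht : 0 < t) (_ : t < 1 / 2) (ε₁ : ℝ), 0 < ε₁ ∧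
      ∀ P : ConformalRectangle, (∀ i, P.mark i = quarterMarks i) →
        (∀ s, dist (P.boundary s)
          ((perturbQuad Ψ (-1 + t) (1 - t) (-1 - t) (1 + t) (by linarith) (by linarith)).boundary s)
            ≤ ε₁) →
        (∀ s, dist (P.boundary s) ((unitSquareQuad.map Ψ).boundary s) ≤ ε) ∧
        P.arc 0 ∪ P.arc 2 ⊆ (closure R.carrier)ᶜ ∧
        closure P.carrier ∩ (R.arc 1 ∪ R.arc 3) = ∅ ∧
        ∃ sIn : ℝ, 0 < sIn ∧
          closure P.carrier \ {z | z ∈ R.carrier ∧ sIn ≤ infDist z (frontier R.carrier)} ⊆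
              {z | infDist z (R.arc 0) < sOut} ∪ {z | infDist z (R.arc 2) < sOut} ∧
          P.arc 0 ⊆ {z | infDist z (R.arc 0) < sOut} ∧
          P.arc 2 ⊆ {z | infDist z (R.arc 2) < sOut} := by
  -- the quad `R` read in the model
  have hclR : closure R.carrier = Ψ '' (Icc (-1) 1 ×ℂ Icc (-1) 1) := by
    rw [← hcar, ← Ψ.image_closure, unitSquareQuad_carrier, Complex.closure_reProdIm,
      closure_Ioo (by norm_num)]
  have hfrR : frontier R.carrier = Ψ '' frontier unitSquareQuad.carrier := by
    rw [← hcar, Ψ.image_frontier]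
  have hfrne : (frontier R.carrier).Nonempty := ⟨_, R.boundary_mem_frontier 0⟩
  have hside0 : ∀ x ∈ Icc (-1 : ℝ) 1, Ψ ⟨x, -1⟩ ∈ R.arc 0 := fun x hx => by
    rw [← h0]; exact mem_image_of_mem _ (SquareModel.mem_arc_zero.2 ⟨rfl, hx⟩)
  have hside2 : ∀ x ∈ Icc (-1 : ℝ) 1, Ψ ⟨x, 1⟩ ∈ R.arc 2 := fun x hx => by
    rw [← h2]; exact mem_image_of_mem _ (SquareModel.mem_arc_two.2 ⟨rfl, hx⟩)
  -- uniform continuity of `Ψ` on `[-2, 2]²` at `sOut / 2`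
  set K₂ : Set ℂ := Icc (-2 : ℝ) 2 ×ℂ Icc (-2 : ℝ) 2 with hK₂
  have hK₂c : IsCompact K₂ := isCompact_Icc.reProdIm isCompact_Icc
  obtain ⟨η, hη, hΨuc⟩ := Metric.uniformContinuousOn_iff_le.1
    (hK₂c.uniformContinuousOn_of_continuous Ψ.continuous.continuousOn) (sOut / 2) (by positivity)
  -- closeness of the perturbed loop to the loop of the quad at `ε / 2`
  obtain ⟨t₀, ht₀, hDt⟩ := exists_forall_dist_perturbQuad_boundary_le Ψ (ε := ε / 2) (by positivity)
  -- the choice of `t`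
  set t : ℝ := min (min (η / 2) t₀) (1 / 4) with htdef
  have ht : 0 < t := by rw [htdef]; positivity
  have ht4 : t ≤ 1 / 4 := min_le_right _ _
  have htη : 2 * t ≤ η := by
    have := (min_le_left (min (η / 2) t₀) (1 / 4)).trans (min_le_left _ _); rw [htdef]; linarith
  have htt₀ : t ≤ t₀ := (min_le_left _ _).trans (min_le_right _ _)
  have hnear : ∀ w ∈ K₂, ∀ w' ∈ K₂, dist w w' ≤ 2 * t → dist (Ψ w) (Ψ w') < sOut :=
    fun w hw w' hw' hd => (hΨuc w hw w' hw' (hd.trans htη)).trans_lt (by linarith)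
  have hx : (-1 + t : ℝ) < 1 - t := by linarith
  have hy : (-1 - t : ℝ) < 1 + t := by linarith
  set D := perturbQuad Ψ (-1 + t) (1 - t) (-1 - t) (1 + t) hx hy with hD
  -- the model tolerance `ε₂` and the uniform continuity of `Ψ⁻¹`
  set ε₂ : ℝ := t / 4 with hε₂
  have hε₂pos : 0 < ε₂ := by positivity
  set K : Set ℂ := Icc (-1 + t) (1 - t) ×ℂ Icc (-1 - t) (1 + t) with hK
  have hKc : IsCompact K := isCompact_Icc.reProdIm isCompact_Icc
  obtain ⟨ε₁', hε₁', -, hΦ⟩ := exists_forall_dist_symm_le Ψ hKc hε₂pos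
  set K' : Set ℂ := Icc (-1 : ℝ) 1 ×ℂ Icc (-1 : ℝ) 1 with hK'
  have hK'c : IsCompact K' := isCompact_Icc.reProdIm isCompact_Icc
  obtain ⟨ε₁'', hε₁'', -, hΦ'⟩ := exists_forall_dist_symm_le Ψ hK'c hε₂pos
  refine ⟨t, ht, by linarith, min ε₁' (ε / 2), by positivity, fun P hmark hclose => ?_⟩
  have hclose' : ∀ s, dist (P.boundary s) (D.boundary s) ≤ ε₁' :=
    fun s => (hclose s).trans (min_le_left _ _)
  have hmarkD : ∀ i, P.mark i = D.mark i := fun i => by rw [hmark, hD, perturbQuad_mark]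
  -- reading a point of `closure P` in the model
  have hfrDne : (frontier D.carrier).Nonempty := ⟨_, D.boundary_mem_frontier 0⟩
  have hfrDc : IsCompact (frontier D.carrier) := D.isCompact_frontier
  have hmodel : ∀ z ∈ closure P.carrier, (Ψ.symm z).re ∈ Icc (-1 + t - ε₂) (1 - t + ε₂) ∧
      (Ψ.symm z).im ∈ Icc (-1 - t - ε₂) (1 + t + ε₂) := by
    intro z hz
    rcases mem_closure_or_infDist_le D.toJordanDomain P.toJordanDomain hclose' hz with h | h
    · rw [hD, mem_closure_perturbQuad_carrier] at h
      obtain ⟨⟨h1, h2⟩, h3, h4⟩ := h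
      exact ⟨⟨by linarith, by linarith⟩, by linarith, by linarith⟩
    · obtain ⟨q, hq, hqd⟩ := hfrDc.exists_infDist_eq_dist hfrDne z
      obtain ⟨q', hq', rfl⟩ := frontier_perturbQuad_subset Ψ _ _ hq
      have hd : dist (Ψ.symm z) q' ≤ ε₂ := hΦ q' hq' z (hqd ▸ h)
      have hre := abs_le.1 (abs_re_sub_le_of_dist_le hd)
      have him := abs_le.1 (abs_im_sub_le_of_dist_le hd)
      obtain ⟨⟨h1, h2⟩, h3, h4⟩ := mem_reProdIm.1 hq'
      exact ⟨⟨by linarith, by linarith⟩, by linarith, by linarith⟩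
  have hmodelK₂ : ∀ z ∈ closure P.carrier, Ψ.symm z ∈ K₂ := fun z hz => by
    obtain ⟨⟨h1, h2⟩, h3, h4⟩ := hmodel z hz
    exact mem_reProdIm.2 ⟨⟨by linarith, by linarith⟩, by linarith, by linarith⟩
  -- reading the arcs of `P` in the model
  have harc : ∀ (i : Fin 4), ∀ z ∈ P.arc i,
      ∃ q' ∈ (rectQuad (-1 + t) (1 - t) (-1 - t) (1 + t) hx hy).arc i, dist (Ψ.symm z) q' ≤ ε₂ := by
    intro i z hz
    obtain ⟨s, rfl, hs⟩ := exists_param_of_mem_arc hmarkD hz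
    rw [hD, perturbQuad, MarkedDomain.arc_map, mem_image_homeomorph_iff] at hs
    refine ⟨_, hs, hΦ _ ?_ _ (by rw [Homeomorph.apply_symm_apply]; exact hclose' s)⟩
    have := frontier_subset_closure
      ((rectQuad (-1 + t) (1 - t) (-1 - t) (1 + t) hx hy).arc_subset_frontier i hs)
    rwa [closure_rectQuad_carrier] at this
  have harcK₂ : ∀ (i : Fin 4), ∀ z ∈ P.arc i, Ψ.symm z ∈ K₂ := fun i z hz =>
    hmodelK₂ z (frontier_subset_closure (P.arc_subset_frontier i hz))
  have harc0 : ∀ z ∈ P.arc 0, (Ψ.symm z).im ≤ -1 - t + ε₂ ∧ (Ψ.symm z).re ∈ Icc (-1 : ℝ) 1 ∧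
      |(Ψ.symm z).im - (-1)| ≤ 2 * t := by
    intro z hz
    obtain ⟨q', hq', hd⟩ := harc 0 z hz
    rw [mem_rectQuad_arc_zero] at hq'
    have him := abs_le.1 (abs_im_sub_le_of_dist_le hd)
    have hre := abs_le.1 (abs_re_sub_le_of_dist_le hd)
    rw [hq'.1] at him
    refine ⟨by linarith, ⟨by linarith [hq'.2.1], by linarith [hq'.2.2]⟩, ?_⟩
    rw [abs_le]; constructor <;> linarith
  have harc2 : ∀ z ∈ P.arc 2, 1 + t - ε₂ ≤ (Ψ.symm z).im ∧ (Ψ.symm z).re ∈ Icc (-1 : ℝ) 1 ∧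
      |(Ψ.symm z).im - 1| ≤ 2 * t := by
    intro z hz
    obtain ⟨q', hq', hd⟩ := harc 2 z hz
    rw [mem_rectQuad_arc_two] at hq'
    have him := abs_le.1 (abs_im_sub_le_of_dist_le hd)
    have hre := abs_le.1 (abs_re_sub_le_of_dist_le hd)
    rw [hq'.1] at him
    refine ⟨by linarith, ⟨by linarith [hq'.2.1], by linarith [hq'.2.2]⟩, ?_⟩
    rw [abs_le]; constructor <;> linarith
  refine ⟨fun s => ?_, ?_, ?_, min ε₁'' sOut, by positivity, ?_, fun z hz => ?_, fun z hz => ?_⟩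
  · -- closeness to the loop of the quad
    calc dist (P.boundary s) ((unitSquareQuad.map Ψ).boundary s)
        ≤ dist (P.boundary s) (D.boundary s) + dist (D.boundary s) ((unitSquareQuad.map Ψ).boundary s) :=
          dist_triangle _ _ _
      _ ≤ ε / 2 + ε / 2 := add_le_add ((hclose s).trans (min_le_right _ _)) (hDt t ht htt₀ (by linarith) s)
      _ = ε := by ring
  · -- the black arcs of `P` lie outside the closed quad
    intro z hz hzR
    rw [hclR, mem_image_homeomorph_iff, mem_reProdIm] at hzR
    rcases hz with hz | hz
    · linarith [(harc0 z hz).1, hzR.2.1]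
    · linarith [(harc2 z hz).1, hzR.2.2]
  · -- the closed `P` misses the free arcs of the quad
    rw [Set.eq_empty_iff_forall_notMem]
    rintro z ⟨hz, hz13⟩
    rw [← h13, mem_image_homeomorph_iff] at hz13
    obtain ⟨hre, -⟩ := hmodel z hz
    rcases hz13 with h | h
    · rw [SquareModel.mem_arc_one] at h; linarith [hre.2, h.1]
    · rw [SquareModel.mem_arc_three] at h; linarith [hre.1, h.1]
  · -- the closed `P` off the `sIn`-interior of the quad is near the black arcs of the quad
    rintro z ⟨hz, hzn⟩
    rw [mem_setOf_eq, not_and, not_le] at hzn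
    obtain ⟨hre, him⟩ := hmodel z hz
    have hwK₂ := hmodelK₂ z hz
    have hzw : Ψ (Ψ.symm z) = z := Ψ.apply_symm_apply z
    have hwre : (Ψ.symm z).re ∈ Icc (-1 : ℝ) 1 := ⟨by linarith [hre.1], by linarith [hre.2]⟩
    by_cases hzR : z ∈ R.carrier
    · -- a point of the quad near its frontier: the near frontier point is on a horizontal side
      have hlt := hzn hzR
      obtain ⟨q, hq, hqd⟩ := R.isCompact_frontier.exists_infDist_eq_dist hfrne z
      rw [hfrR] at hq
      obtain ⟨q', hq', rfl⟩ := hq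
      have hq'K : q' ∈ K' := by
        have := frontier_subset_closure hq'
        rwa [unitSquareQuad_carrier, Complex.closure_reProdIm, closure_Ioo (by norm_num)] at this
      have hd : dist (Ψ.symm z) q' ≤ ε₂ :=
        hΦ' q' hq'K z (by rw [← hqd]; exact hlt.le.trans (min_le_left _ _))
      rw [mem_frontier_unitSquareQuad] at hq'
      rcases hq' with ⟨hq're, hq'im | hq'im⟩ | ⟨hq're, -⟩
      · left
        have hmem : Ψ q' ∈ R.arc 0 := by
          rw [← h0]; exact mem_image_of_mem _ (SquareModel.mem_arc_zero.2 ⟨hq'im, hq're⟩)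
        calc infDist z (R.arc 0) ≤ dist z (Ψ q') := infDist_le_dist_of_mem hmem
          _ = infDist z (frontier R.carrier) := hqd.symm
          _ < min ε₁'' sOut := hlt
          _ ≤ sOut := min_le_right _ _
      · right
        have hmem : Ψ q' ∈ R.arc 2 := by
          rw [← h2]; exact mem_image_of_mem _ (SquareModel.mem_arc_two.2 ⟨hq'im, hq're⟩)
        calc infDist z (R.arc 2) ≤ dist z (Ψ q') := infDist_le_dist_of_mem hmem
          _ = infDist z (frontier R.carrier) := hqd.symm
          _ < min ε₁'' sOut := hlt
          _ ≤ sOut := min_le_right _ _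
      · exfalso
        have hre' := abs_le.1 (abs_re_sub_le_of_dist_le hd)
        rcases hq're with e | e <;> rw [e] at hre' <;> linarith [hre.1, hre.2]
    · -- a point outside the quad: in the model it is above or below the open square
      have hwim : (Ψ.symm z).im ≤ -1 ∨ 1 ≤ (Ψ.symm z).im := by
        by_contra hcon
        push Not at hcon
        apply hzR
        rw [← hcar, mem_image_homeomorph_iff, unitSquareQuad_carrier, mem_reProdIm]
        exact ⟨⟨by linarith [hre.1], by linarith [hre.2]⟩, hcon.1, hcon.2⟩
      rcases hwim with hle | hge
      · left
        rw [mem_setOf_eq, ← hzw]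
        refine infDist_image_lt (by norm_num) hside0 hnear hwK₂ hwre ?_
        rw [abs_le]; constructor <;> linarith [him.1]
      · right
        rw [mem_setOf_eq, ← hzw]
        refine infDist_image_lt (by norm_num) hside2 hnear hwK₂ hwre ?_
        rw [abs_le]; constructor <;> linarith [him.2]
  · -- `P.arc 0` is near `R.arc 0`
    obtain ⟨-, hwre, habs⟩ := harc0 z hz
    rw [mem_setOf_eq, ← Ψ.apply_symm_apply z]
    exact infDist_image_lt (by norm_num) hside0 hnear (harcK₂ 0 z hz) hwre habs
  · -- `P.arc 2` is near `R.arc 2`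
    obtain ⟨-, hwre, habs⟩ := harc2 z hz
    rw [mem_setOf_eq, ← Ψ.apply_symm_apply z]
    exact infDist_image_lt (by norm_num) hside2 hnear (harcK₂ 2 z hz) hwre habs

end DesignLowerContinuum

end Summit.CriticalPhenomena.CardyFormulaZ2.Theorems.CardyQContinuation
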